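import Mathlib
import Summits.Ventures.PercRepro2.Defs
import Summits.Ventures.PercRepro2.Independence
import Summits.Ventures.PercRepro2.Harris
import Summits.Ventures.PercRepro2.Graph
import Summits.Ventures.PercRepro2.Exploration
import Summits.Ventures.PercRepro2.Events
import Summits.Ventures.PercRepro2.FourFunctions
import Summits.Ventures.PercRepro2.Induced
import Summits.Ventures.PercRepro2.Frontier
import Summits.Ventures.PercRepro2.ObsIndependence
import Summits.Ventures.PercRepro2.BHK
import Summits.Ventures.PercRepro2.VdBKahn
import Summits.Ventures.PercRepro2.Merge
import Summits.Ventures.PercRepro2.R2PrimeThreeReduction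
import Summits.Ventures.PercRepro2.YBridge
import Summits.Ventures.PercRepro2.EdgeBHK

/-!
# (N0): `φ_PD ≤ φ` by the edge-cluster BHK inequality in the merged graph
(blind cell PercRepro2, typer-1; `proofs/LEAD-PROOFSHAPES.md` §8.9 ADDENDUM 10 (10b))

Merge `a₁` into `a₂` (`mergeEnds ends a₁ a₂`, same edge type and measure; the cluster of the merged
vertex `a₂` is `Ũ = C(a₁) ∪ C(a₂)`).  In the merged graph apply `bhk_edge` with `s = a₂`,
`X = Y = {a₃}` and the two increasing functionals of the open-edge cluster
`F₁(S) = 1{o ∈ V(S) ∪ {a₂}}` (= `1{o ∈ Ũ}`) and `F₂(S) = 1{S contains an a₁–a₂ path of G}`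
(= `1{a₁ ↔ a₂}`; a function of the EDGE cluster, not of its vertex set):

  `P(o ∈ Ũ, D̃) · P(a₁ ↔ a₂, D̃) ≤ P(o ∈ Ũ, a₁ ↔ a₂, D̃) · P(D̃)`,  `D̃ = {a₃ ∉ Ũ}`  (`n0_cleared`),

i.e. `φ_PD = P(o ∈ Ũ | PD) ≤ φ = P(o ∈ Ũ | D̃)` (`n0`), the hypothesis-free piece of the (Y)
skeleton.
-/

namespace Summit.Ventures.PercRepro2

open UnionCluster

/-! ## Two functionals of an edge set -/

section EdgeFunctionals

variable {V : Type*} {E : Type*}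

/-- The vertices spanned by an edge set. -/
def spanned (ends : E → Sym2 V) (S : Set E) : Set V := {x | ∃ e ∈ S, x ∈ ends e}

/-- `spanned` is monotone. -/
lemma spanned_mono (ends : E → Sym2 V) {S S' : Set E} (h : S ⊆ S') :
    spanned ends S ⊆ spanned ends S' :=
  fun _ ⟨e, he, hx⟩ => ⟨e, h he, hx⟩

/-- The configuration with exactly the edges of the set `S` open. -/
noncomputable def ofSet (S : Set E) : Config E := fun e => by classical exact decide (e ∈ S)

/-- An edge is open in `ofSet S` iff it lies in `S`. -/
lemma ofSet_eq_true_iff {S : Set E} {e : E} : ofSet S e = true ↔ e ∈ S := by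
  simp [ofSet]

/-- `ofSet` is monotone. -/
lemma ofSet_mono {S S' : Set E} (h : S ⊆ S') : ofSet S ≤ ofSet S' := by
  intro e
  by_cases he : e ∈ S
  · rw [ofSet_eq_true_iff.2 (h he)]
    exact le_top
  · have : ofSet S e = false := by
      cases h' : ofSet S e
      · rfl
      · exact absurd (ofSet_eq_true_iff.1 h') he
    rw [this]
    exact Bool.false_le _

/-- `ofSet S ≤ ω` when every edge of `S` is open in `ω`. -/
lemma ofSet_le_of_subset {S : Set E} {ω : Config E} (h : ∀ e ∈ S, ω e = true) : ofSet S ≤ ω := by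
  intro e
  by_cases he : e ∈ S
  · rw [ofSet_eq_true_iff.2 he, h e he]
  · have : ofSet S e = false := by
      cases h' : ofSet S e
      · rfl
      · exact absurd (ofSet_eq_true_iff.1 h') he
    rw [this]
    exact Bool.false_le _

variable {R : Type*} [Zero R] [One R]

/-- `F₁(S) = 1{o ∈ V(S) ∪ {s}}`: `o` is a vertex of the edge set `S` (or the root). -/
noncomputable def memSpannedInd (ends : E → Sym2 V) (s o : V) : Set E → R :=
  fun S => ({S' : Set E | o = s ∨ o ∈ spanned ends S'} : Set (Set E)).indicator 1 S

/-- `F₂(S) = 1{S carries an x–y path}`. -/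
noncomputable def carriesInd (ends : E → Sym2 V) (x y : V) : Set E → R :=
  fun S => ({S' : Set E | Conn ends (ofSet S') x y} : Set (Set E)).indicator 1 S

end EdgeFunctionals

section Monotone

variable {V : Type*} {E : Type*} {R : Type*} [CommRing R] [PartialOrder R] [IsOrderedRing R]

/-- `memSpannedInd` is monotone. -/
lemma monotone_memSpannedInd (ends : E → Sym2 V) (s o : V) :
    Monotone (memSpannedInd (R := R) ends s o) := by
  intro S S' h
  unfold memSpannedInd
  by_cases hS : S ∈ {S' : Set E | o = s ∨ o ∈ spanned ends S'}
  · have hS' : S' ∈ {S' : Set E | o = s ∨ o ∈ spanned ends S'} :=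
      hS.elim Or.inl fun h' => Or.inr (spanned_mono ends h h')
    rw [Set.indicator_of_mem hS, Set.indicator_of_mem hS']
    exact le_rfl
  · rw [Set.indicator_of_notMem hS]
    exact Set.indicator_apply_nonneg fun _ => zero_le_one

/-- `memSpannedInd ≥ 0`. -/
lemma memSpannedInd_nonneg (ends : E → Sym2 V) (s o : V) (S : Set E) :
    0 ≤ memSpannedInd (R := R) ends s o S :=
  Set.indicator_apply_nonneg fun _ => zero_le_one

/-- `carriesInd` is monotone. -/
lemma monotone_carriesInd (ends : E → Sym2 V) (x y : V) :
    Monotone (carriesInd (R := R) ends x y) := by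
  intro S S' h
  unfold carriesInd
  by_cases hS : S ∈ {S' : Set E | Conn ends (ofSet S') x y}
  · have hS' : S' ∈ {S' : Set E | Conn ends (ofSet S') x y} := conn_mono (ofSet_mono h) hS
    rw [Set.indicator_of_mem hS, Set.indicator_of_mem hS']
    exact le_rfl
  · rw [Set.indicator_of_notMem hS]
    exact Set.indicator_apply_nonneg fun _ => zero_le_one

/-- `carriesInd ≥ 0`. -/
lemma carriesInd_nonneg (ends : E → Sym2 V) (x y : V) (S : Set E) :
    0 ≤ carriesInd (R := R) ends x y S :=
  Set.indicator_apply_nonneg fun _ => zero_le_one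

end Monotone

/-! ## The functionals evaluated on the edge cluster of the merged vertex -/

section Merged

variable {V : Type*} {E : Type*} [DecidableEq V]

omit [DecidableEq V] in
/-- A vertex of an edge of the edge cluster lies in the cluster. -/
lemma mem_cluster_of_mem_edgeCluster {ends : E → Sym2 V} {s : V} {ω : Config E} {e : E}
    (he : e ∈ edgeCluster ends s ω) {x : V} (hx : x ∈ ends e) : x ∈ cluster ends ω s := by
  obtain ⟨hopen, x', y', hxy', hx'⟩ := he
  have hadj : OpenAdj ends ω x' y' := ⟨e, hopen, hxy'⟩
  have hy' : y' ∈ cluster ends ω s := conn_trans hx' (conn_of_openAdj hadj)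
  rw [hxy', Sym2.mem_iff] at hx
  rcases hx with rfl | rfl
  · exact hx'
  · exact hy'

/-- `o` is a vertex of the edge cluster of `s` (or `o = s`) iff `o ∈ C(s)`. -/
lemma mem_spanned_edgeCluster_iff (ends : E → Sym2 V) (s o : V) (ω : Config E) :
    (o = s ∨ o ∈ spanned ends (edgeCluster ends s ω)) ↔ o ∈ cluster ends ω s := by
  constructor
  · rintro (rfl | ⟨e, he, ho⟩)
    · exact mem_cluster_self ends ω o
    · exact mem_cluster_of_mem_edgeCluster he ho
  · intro ho
    by_cases hos : o = s
    · exact Or.inl hos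
    · right
      -- the last edge of an open path from `s` to `o`
      have key : o ∈ {x | x = s ∨ ∃ e ∈ edgeCluster ends s ω, x ∈ ends e} := by
        refine mem_of_conn_of_closed (ends := ends) (ω := ω) ?_ (Or.inl rfl) ho
        intro x hx y hxy
        obtain ⟨_, e, he, hends⟩ := openGraph_adj.1 hxy
        have hxC : x ∈ cluster ends ω s := by
          rcases hx with rfl | ⟨e', he', hx'⟩
          · exact mem_cluster_self ends ω x
          · exact mem_cluster_of_mem_edgeCluster he' hx'
        exact Or.inr ⟨e, ⟨he, x, y, hends, hxC⟩, by rw [hends]; exact Sym2.mem_mk_right x y⟩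
      rcases key with h | h
      · exact absurd h hos
      · exact h

omit [DecidableEq V] in
/-- The edges of the edge cluster are open. -/
lemma open_of_mem_edgeCluster {ends : E → Sym2 V} {s : V} {ω : Config E} {e : E}
    (he : e ∈ edgeCluster ends s ω) : ω e = true := he.1

/-- **The edge cluster of the merged vertex carries an `a₁–a₂` path of `G` iff `a₁ ↔ a₂` in `G`**
(`a₁ ≠ a₂`; `a₁` merged into `a₂`). -/
lemma conn_ofSet_edgeCluster_merge_iff (ends : E → Sym2 V) {a₁ a₂ : V} (h12 : a₁ ≠ a₂)
    (ω : Config E) :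
    Conn ends (ofSet (edgeCluster (mergeEnds ends a₁ a₂) a₂ ω)) a₁ a₂ ↔ Conn ends ω a₁ a₂ := by
  constructor
  · exact conn_mono (ofSet_le_of_subset fun e he => open_of_mem_edgeCluster he)
  · intro h
    have h21 : a₂ ≠ a₁ := h12.symm
    -- every open edge of `G` with an endpoint in `Ũ` is an edge of the merged edge cluster
    have hedge : ∀ e x y, ω e = true → ends e = s(x, y) → x ∈ unionCluster ends ω a₂ a₁ →
        e ∈ edgeCluster (mergeEnds ends a₁ a₂) a₂ ω := by
      intro e x y he hxy hxU
      refine ⟨he, mergeVertex a₁ a₂ x, mergeVertex a₁ a₂ y, mergeEnds_apply a₁ a₂ hxy, ?_⟩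
      by_cases hx1 : x = a₁
      · rw [hx1, mergeVertex_self]
        exact mem_cluster_self _ ω a₂
      · rw [mergeVertex_of_ne hx1]
        exact (mem_cluster_merge_iff h21 hx1).2 hxU
    -- the set of vertices of `Ũ` reached from `a₁` inside the edge cluster is closed
    have key : a₂ ∈ {x | x ∈ unionCluster ends ω a₂ a₁ ∧
        Conn ends (ofSet (edgeCluster (mergeEnds ends a₁ a₂) a₂ ω)) a₁ x} := by
      refine mem_of_conn_of_closed (ends := ends) (ω := ω) ?_
        ⟨right_mem_unionCluster ends ω a₂ a₁, conn_refl _ _ _⟩ h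
      rintro x ⟨hxU, hxc⟩ y hxy
      obtain ⟨_, e, he, hends⟩ := openGraph_adj.1 hxy
      have heC := hedge e x y he hends hxU
      have hopen : ofSet (edgeCluster (mergeEnds ends a₁ a₂) a₂ ω) e = true :=
        ofSet_eq_true_iff.2 heC
      exact ⟨mem_unionCluster_of_conn hxU (conn_of_openAdj ⟨e, he, hends⟩),
        conn_trans hxc (conn_of_openAdj ⟨e, hopen, hends⟩)⟩
    exact key.2

end Merged

/-! ## (N0) -/

section N0

variable {V : Type*} {E : Type*} [Fintype E] [DecidableEq E] [Fintype V] [DecidableEq V]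
  {R : Type*} [Field R] [LinearOrder R] [IsStrictOrderedRing R]

omit [Fintype E] [DecidableEq E] [Fintype V] in
/-- `{a₃ ∉ Ũ}` in the merged graph is `D̃`. -/
lemma avoidAll_merge_eq_Dtilde (ends : E → Sym2 V) {a₁ a₂ a₃ : V} (h12 : a₁ ≠ a₂)
    (h31 : a₃ ≠ a₁) :
    avoidAll (mergeEnds ends a₁ a₂) a₂ {a₃} = Dtilde ends a₁ a₂ a₃ := by
  ext ω
  simp only [avoidAll, Set.mem_setOf_eq, Finset.mem_singleton, forall_eq, Dtilde, inU,
    Set.mem_compl_iff, Set.mem_union, mem_connEvent]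
  rw [conn_merge_iff h12.symm h12.symm h31]
  simp only [mem_unionCluster]
  constructor
  · intro h h'
    rcases h' with h' | h'
    · exact h (Or.inr ⟨Or.inl (conn_refl _ _ _), Or.inr (conn_symm h')⟩)
    · exact h (Or.inl (conn_symm h'))
  · intro h h'
    rcases h' with h' | ⟨_, h3⟩
    · exact h (Or.inr (conn_symm h'))
    · rcases h3 with h3 | h3
      · exact h (Or.inr (conn_symm h3))
      · exact h (Or.inl (conn_symm h3))

omit [Fintype E] [DecidableEq E] [Fintype V] [LinearOrder R] [IsStrictOrderedRing R] in
/-- `1{o ∈ Ũ}` as the first functional on the merged edge cluster. -/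
lemma memSpannedInd_edgeCluster_merge (ends : E → Sym2 V) {a₁ a₂ : V} (h12 : a₁ ≠ a₂) {o : V}
    (ho : o ≠ a₁) (ω : Config E) :
    memSpannedInd (R := R) (mergeEnds ends a₁ a₂) a₂ o (edgeCluster (mergeEnds ends a₁ a₂) a₂ ω) =
      (inU ends a₁ a₂ o).indicator 1 ω := by
  unfold memSpannedInd
  have key : (o = a₂ ∨ o ∈ spanned (mergeEnds ends a₁ a₂) (edgeCluster (mergeEnds ends a₁ a₂) a₂ ω))
      ↔ ω ∈ inU ends a₁ a₂ o := by
    rw [mem_spanned_edgeCluster_iff, mem_cluster_merge_iff h12.symm ho, mem_unionCluster]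
    simp only [inU, Set.mem_union, mem_connEvent]
    exact ⟨fun h => h.elim (fun h => Or.inr (conn_symm h)) (fun h => Or.inl (conn_symm h)),
      fun h => h.elim (fun h => Or.inr (conn_symm h)) (fun h => Or.inl (conn_symm h))⟩
  by_cases h : ω ∈ inU ends a₁ a₂ o
  · rw [Set.indicator_of_mem h, Set.indicator_of_mem (show edgeCluster (mergeEnds ends a₁ a₂) a₂ ω ∈
      {S' : Set E | o = a₂ ∨ o ∈ spanned (mergeEnds ends a₁ a₂) S'} from key.2 h)]
    rfl
  · rw [Set.indicator_of_notMem h, Set.indicator_of_notMem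
      (show edgeCluster (mergeEnds ends a₁ a₂) a₂ ω ∉
        {S' : Set E | o = a₂ ∨ o ∈ spanned (mergeEnds ends a₁ a₂) S'} from fun h' => h (key.1 h'))]

omit [Fintype E] [DecidableEq E] [Fintype V] [LinearOrder R] [IsStrictOrderedRing R] in
/-- `1{a₁ ↔ a₂}` as the second functional on the merged edge cluster. -/
lemma carriesInd_edgeCluster_merge (ends : E → Sym2 V) {a₁ a₂ : V} (h12 : a₁ ≠ a₂)
    (ω : Config E) :
    carriesInd (R := R) ends a₁ a₂ (edgeCluster (mergeEnds ends a₁ a₂) a₂ ω) =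
      (connEvent ends a₁ a₂).indicator 1 ω := by
  unfold carriesInd
  have key := conn_ofSet_edgeCluster_merge_iff ends h12 ω
  by_cases h : ω ∈ connEvent ends a₁ a₂
  · rw [Set.indicator_of_mem h, Set.indicator_of_mem (show edgeCluster (mergeEnds ends a₁ a₂) a₂ ω ∈
      {S' : Set E | Conn ends (ofSet S') a₁ a₂} from key.2 h)]
    rfl
  · rw [Set.indicator_of_notMem h, Set.indicator_of_notMem
      (show edgeCluster (mergeEnds ends a₁ a₂) a₂ ω ∉ {S' : Set E | Conn ends (ofSet S') a₁ a₂} from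
        fun h' => h (key.1 h'))]

/-- **(N0), cleared form**: `P(o ∈ Ũ, D̃) · P(a₁ ↔ a₂, D̃) ≤ P(o ∈ Ũ, a₁ ↔ a₂, D̃) · P(D̃)`
(BHK Thm 1.1 in the merged graph `G/(a₁ = a₂)` with the edge-cluster events `{o ∈ Ũ}` and
`{a₁ ↔ a₂}`, avoiding `a₃`). -/
theorem n0_cleared (p : E → R) (hp : IsProbVec p) (ends : E → Sym2 V) {o a₁ a₂ a₃ : V}
    (h12 : a₁ ≠ a₂) (h31 : a₃ ≠ a₁) (ho : o ≠ a₁) :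
    prob p (inU ends a₁ a₂ o ∩ Dtilde ends a₁ a₂ a₃) *
        prob p (connEvent ends a₁ a₂ ∩ Dtilde ends a₁ a₂ a₃) ≤
      prob p (inU ends a₁ a₂ o ∩ connEvent ends a₁ a₂ ∩ Dtilde ends a₁ a₂ a₃) *
        prob p (Dtilde ends a₁ a₂ a₃) := by
  have h := bhk_edge p hp (mergeEnds ends a₁ a₂) a₂
    (monotone_memSpannedInd (R := R) (mergeEnds ends a₁ a₂) a₂ o)
    (monotone_carriesInd (R := R) ends a₁ a₂) (memSpannedInd_nonneg _ _ _)
    (carriesInd_nonneg _ _ _) {a₃} {a₃}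
  simp only [Finset.inter_self, Finset.union_self, avoidAll_merge_eq_Dtilde ends h12 h31,
    Pi.mul_apply, memSpannedInd_edgeCluster_merge ends h12 ho, carriesInd_edgeCluster_merge ends h12]
    at h
  -- the four expectations are the four probabilities
  have e1 : expect p (fun ω => (inU ends a₁ a₂ o).indicator 1 ω *
      (Dtilde ends a₁ a₂ a₃).indicator 1 ω) = prob p (inU ends a₁ a₂ o ∩ Dtilde ends a₁ a₂ a₃) := by
    rw [prob_eq_expect_indicator]; unfold expect
    exact Finset.sum_congr rfl fun ω _ => by rw [indicator_inter_one]
  have e2 : expect p (fun ω => (connEvent ends a₁ a₂).indicator 1 ω *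
      (Dtilde ends a₁ a₂ a₃).indicator 1 ω) =
      prob p (connEvent ends a₁ a₂ ∩ Dtilde ends a₁ a₂ a₃) := by
    rw [prob_eq_expect_indicator]; unfold expect
    exact Finset.sum_congr rfl fun ω _ => by rw [indicator_inter_one]
  have e3 : expect p (fun ω => (inU ends a₁ a₂ o).indicator 1 ω *
      (connEvent ends a₁ a₂).indicator 1 ω * (Dtilde ends a₁ a₂ a₃).indicator 1 ω) =
      prob p (inU ends a₁ a₂ o ∩ connEvent ends a₁ a₂ ∩ Dtilde ends a₁ a₂ a₃) := by
    rw [prob_eq_expect_indicator]; unfold expect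
    exact Finset.sum_congr rfl fun ω _ => by rw [indicator_inter_one, indicator_inter_one]
  rw [e1, e2, e3] at h
  exact h

/-- **(N0)**: `φ_PD = P(o ∈ Ũ | PD) ≤ φ = P(o ∈ Ũ | D̃)` (ratio form, `x / 0 = 0`), for
`P(PD) > 0`. -/
theorem n0 (p : E → R) (hp : IsProbVec p) (ends : E → Sym2 V) {o a₁ a₂ a₃ : V} (h12 : a₁ ≠ a₂)
    (h31 : a₃ ≠ a₁) (ho : o ≠ a₁) (hPD : 0 < prob p (PDEvent ends a₁ a₂ a₃)) :
    prob p (inU ends a₁ a₂ o ∩ PDEvent ends a₁ a₂ a₃) / prob p (PDEvent ends a₁ a₂ a₃) ≤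
      phi p ends o a₁ a₂ a₃ := by
  have hD : 0 < prob p (Dtilde ends a₁ a₂ a₃) :=
    lt_of_lt_of_le hPD (prob_mono hp (Set.inter_subset_right))
  unfold phi
  rw [div_le_div_iff₀ hPD hD]
  have key := n0_cleared p hp ends h12 h31 ho
  -- split `D̃` along `{a₁ ↔ a₂}`
  have s1 := prob_inter_add_prob_inter_compl p (Dtilde ends a₁ a₂ a₃) (connEvent ends a₁ a₂)
  have s2 := prob_inter_add_prob_inter_compl p (inU ends a₁ a₂ o ∩ Dtilde ends a₁ a₂ a₃)
    (connEvent ends a₁ a₂)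
  have e1 : Dtilde ends a₁ a₂ a₃ ∩ connEvent ends a₁ a₂ =
      connEvent ends a₁ a₂ ∩ Dtilde ends a₁ a₂ a₃ := Set.inter_comm _ _
  have e2 : Dtilde ends a₁ a₂ a₃ ∩ (connEvent ends a₁ a₂)ᶜ = PDEvent ends a₁ a₂ a₃ :=
    Set.inter_comm _ _
  have e3 : inU ends a₁ a₂ o ∩ Dtilde ends a₁ a₂ a₃ ∩ connEvent ends a₁ a₂ =
      inU ends a₁ a₂ o ∩ connEvent ends a₁ a₂ ∩ Dtilde ends a₁ a₂ a₃ := Set.inter_right_comm _ _ _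
  have e4 : inU ends a₁ a₂ o ∩ Dtilde ends a₁ a₂ a₃ ∩ (connEvent ends a₁ a₂)ᶜ =
      inU ends a₁ a₂ o ∩ PDEvent ends a₁ a₂ a₃ := by
    unfold PDEvent
    ext ω; simp only [Set.mem_inter_iff]; tauto
  rw [e1, e2] at s1
  rw [e3, e4] at s2
  nlinarith [key, s1, s2, prob_nonneg hp (inU ends a₁ a₂ o ∩ Dtilde ends a₁ a₂ a₃),
    prob_nonneg hp (connEvent ends a₁ a₂ ∩ Dtilde ends a₁ a₂ a₃)]

end N0

end Summit.Ventures.PercRepro2
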